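import Summits.Ventures.HodgeRepro2.T6B1Local

/-!
# T6B1Determinant — «its determinant» in Liu's Def. C.3 (Tier-6 sub-goal B1, proof lane)

`IsIncoherentSpace` (T6B1Carriers) reads Def. C.3's clause «its determinant belongs to A_F^× \ F^× N_{A_E/A_F} A_E^×»
on `gram.det.re`. This file records why that is the determinant itself: over `A_F` the element `2` is a unit, so the
determinant of a hermitian Gram matrix over `A_E = A_F[ω]/(ω² = θ)` is `c`-invariant and equals the image of its
real part (`gram_det_eq`), it is a unit of `A_F` (`isUnit_det_re`, the «A_F^×» half of the clause), and the
predicate is equivalent to the literal statement about `gram.det` in `A_E` (`isIncoherentSpace_iff`).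
-/

namespace Summit.Ventures.HodgeRepro2.T6
namespace B1Determinant

open NumberField B1Carriers B1Local

variable (K : Type*) [Field K] [NumberField K]

/-- `2` is a unit of `A_F` (`A_F` is a `K`-algebra, `K` of characteristic zero). -/
theorem isUnit_two_AK : IsUnit (2 : AK K) := by
  rw [← map_ofNat (algebraMap K (AK K)) 2]
  exact (isUnit_iff_ne_zero.2 two_ne_zero).map _

/-- The determinant of the Gram matrix of an adelic hermitian space is the image of its real part. -/
theorem gram_det_eq {θ : K} {n : ℕ} (V : AdelicHermitianSpace K θ n) :
    V.gram.det = algebraMap (AK K) (AE K θ) V.gram.det.re :=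
  det_eq_algebraMap_re_of_isHermitian V.isHermitian (isUnit_two_AK K)

/-- «Its determinant belongs to A_F^×»: the real part of the determinant is a unit of `A_F`. -/
theorem isUnit_det_re {θ : K} {n : ℕ} (V : AdelicHermitianSpace K θ n) : IsUnit V.gram.det.re := by
  have h := V.isUnit_det
  rw [gram_det_eq] at h
  rw [QuadraticAlgebra.isUnit_iff_norm_isUnit, QuadraticAlgebra.norm_algebraMap] at h
  exact (isUnit_pow_iff two_ne_zero).1 h

/-- `IsIncoherentSpace` is the literal Def. C.3 clause on the determinant in `A_E`: the determinant is not
`f · N_{A_E/A_F}(x)` for `f ∈ F^×`, `x ∈ A_E^×` (the norm read in `A_E` through `algebraMap`). -/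
theorem isIncoherentSpace_iff {θ : K} {n : ℕ} (V : AdelicHermitianSpace K θ n) :
    IsIncoherentSpace K V ↔ ¬ ∃ (f : Kˣ) (x : (AE K θ)ˣ),
      V.gram.det = algebraMap K (AE K θ) (f : K) * algebraMap (AK K) (AE K θ) (QuadraticAlgebra.norm (x : AE K θ)) := by
  unfold IsIncoherentSpace
  constructor
  · rintro h ⟨f, x, hfx⟩
    apply h
    refine ⟨f, x, ?_⟩
    have := congrArg QuadraticAlgebra.re hfx
    rw [QuadraticAlgebra.re_mul] at this
    simpa [QuadraticAlgebra.algebraMap_eq, IsScalarTower.algebraMap_apply K (AK K) (AE K θ)] using this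
  · rintro h ⟨f, x, hfx⟩
    apply h
    refine ⟨f, x, ?_⟩
    rw [gram_det_eq, hfx, IsScalarTower.algebraMap_apply K (AK K) (AE K θ), map_mul]

end B1Determinant
end Summit.Ventures.HodgeRepro2.T6
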